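import Summits.ResolutionOfSingularities.ResolutionOfSingularities.Theorems.PurelyInseparableDim4ResConeSliceCSocket
import Summits.ResolutionOfSingularities.ResolutionOfSingularities.Theorems.PurelyInseparableDim4ResConeTwoSlotTailRotation
import Summits.ResolutionOfSingularities.ResolutionOfSingularities.Theorems.PurelyInseparableDim4SwapTransportWindowClose
import Summits.ResolutionOfSingularities.ResolutionOfSingularities.Theorems.PurelyInseparableDim4ResConeRepresentationSockets
import Summits.ResolutionOfSingularities.ResolutionOfSingularities.Theorems.PurelyInseparableDim4ResConeBInfAssembly
import Summits.ResolutionOfSingularities.ResolutionOfSingularities.Theorems.PurelyInseparableDim4ResConeTiltedTail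
import HarnessLib
import HarnessLib.Audit.Tags

/-!
# Purely inseparable four-folds — K2(5) ⟺ TAIL-B ∧ TAIL-D WITH NO PRESENTATION RESIDUAL, and K2(5) FROM FIVE NAMED RESIDUALS
# (the Φ-line's two step laws K/L and three re-presentation hypotheses hN4-C / hN4-C′ / hN4-D) — the K2(p) lane's LEDGER THEOREM v8
# (cell `res-dim4-pi`, K2(p) lane holder file)

[OURS · counted 0 · cell `res-dim4-pi` · K2(p) lane holder res-dim4-p-12 g4 (memo §17c).]  Nothing here proves K2(5)
(`RidgeBudget.NoAboveFloorTrap 5 5`), `NoIsolatedTrap 5 5` or resolution of singularities in dimension ≥ 4 / characteristic `p` —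
NOT proved: `noAboveFloorTrap_five_of_residuals` is CONDITIONAL on five named hypotheses.  AI kernel work, weaker than expert review.

* **`noAboveFloorTrap_five_iff_tails`** — the socket theorem `noAboveFloorTrap_five_iff_no_binaryCone_tails (hslotT) (hN4)` (p700823) with
  BOTH presentation residuals DISCHARGED BY NAME: `hslotT := ResCone.twoSlot_slotT_residual` (res-dim4-p-1 g4, `…TwoSlotTailRotation`
  p701277: the two-slot `d = 3` tail is empty, rotations included) and `hN4 := SwapTransport.cInf_rotation_residual` (res-dim4-typ-1 g3,
  `…SwapTransportWindowClose`: the C∞ `d = 4` chain is empty, rotations included, via the virtual window and res-dim4-p-3 g4's entries).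
  So **K2(5) ⟺ over every field of characteristic 5, TAIL-B (no shade-3 `e_G = 2` witnessed tail) ∧ TAIL-D (no shade-4 `e_G = 2`
  witnessed tail)** — slice B is CLOSED in the kernel, unconditionally; K2(5) IS slice C.
* **`noAboveFloorTrap_five_of_residuals (hN4C) (hK) (hL) (hN4C') (hN4D)`** — K2(5) from: hN4-C (light `(5,3)` re-presentation),
  the Φ-line's KEEP law `hK` and LOSE law `hL` in carried linear frames (binders = res-dim4-p-9 g4's `tailB_three_five_of_KL_of_light`,
  p703425, i.e. the holder's skeleton stubs K/L unfolded; owners res-dim4-p-7 g4 / res-dim4-p-2 g5 over res-dim4-p-11 g4's (K-Φ2)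
  XII–XIV), hN4-C′ (light-pair `(5,4)` re-presentation) and hN4-D (D∞ pair-confinement re-presentation) — using, by name, W/W₄, the
  potential assembly (p702997) with the entry law discharged (res-dim4-p-9 g4 `stub_entryFrame` p702794), the re-presentation sockets
  (p703603), C13 `no_lossfree_tail` (res-dim4-p-5 g3) and `no_pair_tail_four_five` (res-dim4-p-5 g4, p703039).
This is the exact list of what the cell has NOT typed for K2(5) on 2026-08-29 06:50Z.

[cite: CossartJannsenSaito2020, Thm. 3.14, Lemma 13.4, Thm. 13.7] [cite: HauserPerlega2019PRIMS, §2 (transform D′ of D)]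
bears_on: LADDER-RESOLUTION:D157-DOOR2 (res-dim4-pi · K2(p) · ledger theorem v8).  Supports stmt-ResolutionOfSingularities-16155 (helper).
-/

set_option linter.dupNamespace false -- mandated namespace of this single-conjunct summit

noncomputable section

namespace Summit.ResolutionOfSingularities.ResolutionOfSingularities.Theorems.PIDim4

namespace ResCone

open MvPolynomial Finset
open Literature.AlgebraicGeometry.Resolution
open Literature.AlgebraicGeometry.Resolution.CentreBlowup
open Literature.AlgebraicGeometry.Resolution.Hauser2010
open Literature.AlgebraicGeometry.Resolution.HauserPerlega2019
open Literature.AlgebraicGeometry.Resolution.WeightedOrder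
open RidgeBudget (NoAboveFloorTrap)

/-- **K2(5) ⟺ TAIL-B ∧ TAIL-D, NO PRESENTATION RESIDUAL** (slice B closed in the kernel): `RidgeBudget.NoAboveFloorTrap 5 5` holds iff
over every field of characteristic `5` no witnessed all-isolated above-floor `Step0 5` chain with `x^{r₀} ∣ F₀` has, from some `k₀` on,
constant shade `3` and `e_G = 2` (TAIL-B), and none has constant shade `4` and `e_G = 2` (TAIL-D).  The socket with
`hslotT := twoSlot_slotT_residual` and `hN4 := SwapTransport.cInf_rotation_residual`. [OURS] [cite: CossartJannsenSaito2020, Thm. 3.14] -/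
theorem noAboveFloorTrap_five_iff_tails :
    NoAboveFloorTrap 5 5 ↔ ∀ (K : Type) [Field K] [CharP K 5] [DecidableEq K],
      (∀ (c : ℕ → State K) (j : ℕ → Fin 4) (b : ℕ → Fin 4 → K),
        (∀ k, IsIsolated 5 (c k).F ∧ Step0 5 (c k) (c (k + 1))) → FreeTail.IsWitnessedChain 5 c j b →
        (∀ e ∈ (c 0).F.support, (c 0).r ≤ e) → (∀ k, ordZero (c k).F ≠ (5 : ℕ)) →
        ∀ k₀ : ℕ, (∀ k, k₀ ≤ k → (c k).shade = ((3 : ℕ) : ℕ∞)) →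
        (∀ k, k₀ ≤ k → Module.finrank K (resVertex (c k)) = 2) → False) ∧
      (∀ (c : ℕ → State K) (j : ℕ → Fin 4) (b : ℕ → Fin 4 → K),
        (∀ k, IsIsolated 5 (c k).F ∧ Step0 5 (c k) (c (k + 1))) → FreeTail.IsWitnessedChain 5 c j b →
        (∀ e ∈ (c 0).F.support, (c 0).r ≤ e) → (∀ k, ordZero (c k).F ≠ (5 : ℕ)) →
        ∀ k₀ : ℕ, (∀ k, k₀ ≤ k → (c k).shade = ((4 : ℕ) : ℕ∞)) →
        (∀ k, k₀ ≤ k → Module.finrank K (resVertex (c k)) = 2) → False) :=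
  noAboveFloorTrap_five_iff_no_binaryCone_tails twoSlot_slotT_residual SwapTransport.cInf_rotation_residual

/-- **K2(5) FROM FIVE NAMED RESIDUALS (ledger theorem v8).**  `RidgeBudget.NoAboveFloorTrap 5 5` follows from: (hN4-C) every light
`(5,3)` binary-cone tail admits a loss-free re-presentation; (hK)/(hL) the Φ-line's KEEP / LOSE laws for the carried label of a B∞ `(5,3)`
tail (res-dim4-p-9 g4's binders verbatim); (hN4-C′) every light-pair `(5,4)` tail admits a loss-free re-presentation; (hN4-D) every D∞
`(5,4)` tail admits a pair-confined passive-free re-presentation.  Everything else is in the tree: weights W/W₄, the potential assembly with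
its entry law, C13, the pair-tail kill, slice B. [OURS · conditional on the five named hypotheses]
[cite: CossartJannsenSaito2020, Thm. 3.14, Lemma 13.4, Thm. 13.7] -/
theorem noAboveFloorTrap_five_of_residuals
    (hN4C : ∀ (K : Type) [Field K] [CharP K 5] [DecidableEq K], 
      ∀ (c : ℕ → State K) (j : ℕ → Fin 4) (b : ℕ → Fin 4 → K),
      (∀ k, IsIsolated 5 (c k).F ∧ Step0 5 (c k) (c (k + 1))) → FreeTail.IsWitnessedChain 5 c j b →
      (∀ e ∈ (c 0).F.support, (c 0).r ≤ e) → (∀ k, ordZero (c k).F ≠ (5 : ℕ)) →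
      ∀ k₀ : ℕ, (∀ k, k₀ ≤ k → (c k).shade = ((3 : ℕ) : ℕ∞)) →
      (∀ k, k₀ ≤ k → Module.finrank K (resVertex (c k)) = 2) →
      (∀ k, k₀ ≤ k → (∀ i, (c k).r i ≤ 1) ∧ (c k).r.degree = 3) →
      ∃ (c' : ℕ → State K) (j' : ℕ → Fin 4) (b' : ℕ → Fin 4 → K) (k₀' : ℕ),
        (∀ k, IsIsolated 5 (c' k).F ∧ Step0 5 (c' k) (c' (k + 1))) ∧ FreeTail.IsWitnessedChain 5 c' j' b' ∧
        (∀ e ∈ (c' 0).F.support, (c' 0).r ≤ e) ∧ (∀ k, ordZero (c' k).F ≠ (5 : ℕ)) ∧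
        (∀ k, k₀' ≤ k → (c' k).shade = ((3 : ℕ) : ℕ∞)) ∧
        (∀ k, k₀' ≤ k → Module.finrank K (resVertex (c' k)) = 2) ∧
        (∀ k, k₀' ≤ k → ∀ i, b' k i ≠ 0 → (c' k).r i = 0))
    (hK : ∀ (K : Type) [Field K] [CharP K 5] [DecidableEq K] (c : ℕ → State K) (j : ℕ → Fin 4) (b : ℕ → Fin 4 → K),
      (∀ k, IsIsolated 5 (c k).F ∧ Step0 5 (c k) (c (k + 1))) → FreeTail.IsWitnessedChain 5 c j b →
      (∀ e ∈ (c 0).F.support, (c 0).r ≤ e) → (∀ k, ordZero (c k).F ≠ (5 : ℕ)) →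
      ∀ k₀ : ℕ, (∀ k, k₀ ≤ k → (c k).shade = ((3 : ℕ) : ℕ∞)) →
      (∀ k, k₀ ≤ k → Module.finrank K (resVertex (c k)) = 2) →
      ∀ k, k₀ ≤ k → (c k).r.degree = 3 → ∀ (h : Fin 4) (L : Fin (2 + 2) → Fin 4 → K) (M : Fin 4 → Fin (2 + 2) → K),
      ((∀ t u, ∑ i, M t i * L i u = if t = u then 1 else 0) ∧ L (u1 2) = Pi.single h 1 ∧
        (∀ i, i ≠ u1 2 → i ≠ u2 2 → ∀ w ∈ resVertex (c k), ∑ t, L i t * w t = 0) ∧ (c k).r h = 2 ∧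
        (pts (fun i => algebraMap (MvPolynomial (Fin 4) K) (OriginLocalization K 4) (∑ t, C (L i t) * X t))
          (Ideal.span {algebraMap (MvPolynomial (Fin 4) K) (OriginLocalization K 4)
            ((c k).F.divMonomial (c k).r)}) 3).Nonempty ∧
        Nat.factorial 3 < deltaS (fun i => algebraMap (MvPolynomial (Fin 4) K) (OriginLocalization K 4)
          (∑ t, C (L i t) * X t)) (Ideal.span {algebraMap (MvPolynomial (Fin 4) K) (OriginLocalization K 4)
            ((c k).F.divMonomial (c k).r)}) 3 ∧
        alphaS (fun i => algebraMap (MvPolynomial (Fin 4) K) (OriginLocalization K 4) (∑ t, C (L i t) * X t))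
          (Ideal.span {algebraMap (MvPolynomial (Fin 4) K) (OriginLocalization K 4)
            ((c k).F.divMonomial (c k).r)}) 3 < Nat.factorial 3) ∧
      0 < alphaS (fun i => algebraMap (MvPolynomial (Fin 4) K) (OriginLocalization K 4) (∑ t, C (L i t) * X t))
          (Ideal.span {algebraMap (MvPolynomial (Fin 4) K) (OriginLocalization K 4)
            ((c k).F.divMonomial (c k).r)}) 3 →
      ∃ (L' : Fin (2 + 2) → Fin 4 → K) (M' : Fin 4 → Fin (2 + 2) → K),
        (((∀ t u, ∑ i, M' t i * L' i u = if t = u then 1 else 0) ∧ L' (u1 2) = Pi.single h 1 ∧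
          (∀ i, i ≠ u1 2 → i ≠ u2 2 → ∀ w ∈ resVertex (c (k + 1)), ∑ t, L' i t * w t = 0) ∧ (c (k + 1)).r h = 2 ∧
          (pts (fun i => algebraMap (MvPolynomial (Fin 4) K) (OriginLocalization K 4) (∑ t, C (L' i t) * X t))
            (Ideal.span {algebraMap (MvPolynomial (Fin 4) K) (OriginLocalization K 4)
              ((c (k + 1)).F.divMonomial (c (k + 1)).r)}) 3).Nonempty ∧
          Nat.factorial 3 < deltaS (fun i => algebraMap (MvPolynomial (Fin 4) K) (OriginLocalization K 4)
            (∑ t, C (L' i t) * X t)) (Ideal.span {algebraMap (MvPolynomial (Fin 4) K) (OriginLocalization K 4)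
              ((c (k + 1)).F.divMonomial (c (k + 1)).r)}) 3 ∧
          alphaS (fun i => algebraMap (MvPolynomial (Fin 4) K) (OriginLocalization K 4) (∑ t, C (L' i t) * X t))
            (Ideal.span {algebraMap (MvPolynomial (Fin 4) K) (OriginLocalization K 4)
              ((c (k + 1)).F.divMonomial (c (k + 1)).r)}) 3 < Nat.factorial 3) ∧
        0 < alphaS (fun i => algebraMap (MvPolynomial (Fin 4) K) (OriginLocalization K 4) (∑ t, C (L' i t) * X t))
            (Ideal.span {algebraMap (MvPolynomial (Fin 4) K) (OriginLocalization K 4)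
              ((c (k + 1)).F.divMonomial (c (k + 1)).r)}) 3) ∧
        betaS (fun i => algebraMap (MvPolynomial (Fin 4) K) (OriginLocalization K 4) (∑ t, C (L' i t) * X t))
            (Ideal.span {algebraMap (MvPolynomial (Fin 4) K) (OriginLocalization K 4)
              ((c (k + 1)).F.divMonomial (c (k + 1)).r)}) 3 <
          betaS (fun i => algebraMap (MvPolynomial (Fin 4) K) (OriginLocalization K 4) (∑ t, C (L i t) * X t))
            (Ideal.span {algebraMap (MvPolynomial (Fin 4) K) (OriginLocalization K 4)
              ((c k).F.divMonomial (c k).r)}) 3)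
    (hL : ∀ (K : Type) [Field K] [CharP K 5] [DecidableEq K] (c : ℕ → State K) (j : ℕ → Fin 4) (b : ℕ → Fin 4 → K),
      (∀ k, IsIsolated 5 (c k).F ∧ Step0 5 (c k) (c (k + 1))) → FreeTail.IsWitnessedChain 5 c j b →
      (∀ e ∈ (c 0).F.support, (c 0).r ≤ e) → (∀ k, ordZero (c k).F ≠ (5 : ℕ)) →
      ∀ k₀ : ℕ, (∀ k, k₀ ≤ k → (c k).shade = ((3 : ℕ) : ℕ∞)) →
      (∀ k, k₀ ≤ k → Module.finrank K (resVertex (c k)) = 2) →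
      ∀ k, k₀ ≤ k → (c k).r.degree = 4 → ∀ (h : Fin 4) (L : Fin (2 + 2) → Fin 4 → K) (M : Fin 4 → Fin (2 + 2) → K),
      ((∀ t u, ∑ i, M t i * L i u = if t = u then 1 else 0) ∧ L (u1 2) = Pi.single h 1 ∧
        (∀ i, i ≠ u1 2 → i ≠ u2 2 → ∀ w ∈ resVertex (c k), ∑ t, L i t * w t = 0) ∧ (c k).r h = 2 ∧
        (pts (fun i => algebraMap (MvPolynomial (Fin 4) K) (OriginLocalization K 4) (∑ t, C (L i t) * X t))
          (Ideal.span {algebraMap (MvPolynomial (Fin 4) K) (OriginLocalization K 4)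
            ((c k).F.divMonomial (c k).r)}) 3).Nonempty ∧
        Nat.factorial 3 < deltaS (fun i => algebraMap (MvPolynomial (Fin 4) K) (OriginLocalization K 4)
          (∑ t, C (L i t) * X t)) (Ideal.span {algebraMap (MvPolynomial (Fin 4) K) (OriginLocalization K 4)
            ((c k).F.divMonomial (c k).r)}) 3 ∧
        alphaS (fun i => algebraMap (MvPolynomial (Fin 4) K) (OriginLocalization K 4) (∑ t, C (L i t) * X t))
          (Ideal.span {algebraMap (MvPolynomial (Fin 4) K) (OriginLocalization K 4)
            ((c k).F.divMonomial (c k).r)}) 3 < Nat.factorial 3) →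
      ∃ (L' : Fin (2 + 2) → Fin 4 → K) (M' : Fin 4 → Fin (2 + 2) → K),
        (((∀ t u, ∑ i, M' t i * L' i u = if t = u then 1 else 0) ∧ L' (u1 2) = Pi.single (j k) 1 ∧
          (∀ i, i ≠ u1 2 → i ≠ u2 2 → ∀ w ∈ resVertex (c (k + 1)), ∑ t, L' i t * w t = 0) ∧ (c (k + 1)).r (j k) = 2 ∧
          (pts (fun i => algebraMap (MvPolynomial (Fin 4) K) (OriginLocalization K 4) (∑ t, C (L' i t) * X t))
            (Ideal.span {algebraMap (MvPolynomial (Fin 4) K) (OriginLocalization K 4)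
              ((c (k + 1)).F.divMonomial (c (k + 1)).r)}) 3).Nonempty ∧
          Nat.factorial 3 < deltaS (fun i => algebraMap (MvPolynomial (Fin 4) K) (OriginLocalization K 4)
            (∑ t, C (L' i t) * X t)) (Ideal.span {algebraMap (MvPolynomial (Fin 4) K) (OriginLocalization K 4)
              ((c (k + 1)).F.divMonomial (c (k + 1)).r)}) 3 ∧
          alphaS (fun i => algebraMap (MvPolynomial (Fin 4) K) (OriginLocalization K 4) (∑ t, C (L' i t) * X t))
            (Ideal.span {algebraMap (MvPolynomial (Fin 4) K) (OriginLocalization K 4)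
              ((c (k + 1)).F.divMonomial (c (k + 1)).r)}) 3 < Nat.factorial 3) ∧
        0 < alphaS (fun i => algebraMap (MvPolynomial (Fin 4) K) (OriginLocalization K 4) (∑ t, C (L' i t) * X t))
            (Ideal.span {algebraMap (MvPolynomial (Fin 4) K) (OriginLocalization K 4)
              ((c (k + 1)).F.divMonomial (c (k + 1)).r)}) 3) ∧
        betaS (fun i => algebraMap (MvPolynomial (Fin 4) K) (OriginLocalization K 4) (∑ t, C (L' i t) * X t))
            (Ideal.span {algebraMap (MvPolynomial (Fin 4) K) (OriginLocalization K 4)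
              ((c (k + 1)).F.divMonomial (c (k + 1)).r)}) 3 ≤
          betaS (fun i => algebraMap (MvPolynomial (Fin 4) K) (OriginLocalization K 4) (∑ t, C (L i t) * X t))
            (Ideal.span {algebraMap (MvPolynomial (Fin 4) K) (OriginLocalization K 4)
              ((c k).F.divMonomial (c k).r)}) 3)
    (hN4C' : ∀ (K : Type) [Field K] [CharP K 5] [DecidableEq K], 
      ∀ (c : ℕ → State K) (j : ℕ → Fin 4) (b : ℕ → Fin 4 → K),
      (∀ k, IsIsolated 5 (c k).F ∧ Step0 5 (c k) (c (k + 1))) → FreeTail.IsWitnessedChain 5 c j b →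
      (∀ e ∈ (c 0).F.support, (c 0).r ≤ e) → (∀ k, ordZero (c k).F ≠ (5 : ℕ)) →
      ∀ k₀ : ℕ, (∀ k, k₀ ≤ k → (c k).shade = ((4 : ℕ) : ℕ∞)) →
      (∀ k, k₀ ≤ k → Module.finrank K (resVertex (c k)) = 2) →
      (∀ k, k₀ ≤ k → (∀ i, (c k).r i ≤ 1) ∧ (c k).r.degree = 2) →
      ∃ (c' : ℕ → State K) (j' : ℕ → Fin 4) (b' : ℕ → Fin 4 → K) (k₀' : ℕ),
        (∀ k, IsIsolated 5 (c' k).F ∧ Step0 5 (c' k) (c' (k + 1))) ∧ FreeTail.IsWitnessedChain 5 c' j' b' ∧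
        (∀ e ∈ (c' 0).F.support, (c' 0).r ≤ e) ∧ (∀ k, ordZero (c' k).F ≠ (5 : ℕ)) ∧
        (∀ k, k₀' ≤ k → (c' k).shade = ((4 : ℕ) : ℕ∞)) ∧
        (∀ k, k₀' ≤ k → Module.finrank K (resVertex (c' k)) = 2) ∧
        (∀ k, k₀' ≤ k → ∀ i, b' k i ≠ 0 → (c' k).r i = 0))
    (hN4D : ∀ (K : Type) [Field K] [CharP K 5] [DecidableEq K], 
      ∀ (c : ℕ → State K) (j : ℕ → Fin 4) (b : ℕ → Fin 4 → K),
      (∀ k, IsIsolated 5 (c k).F ∧ Step0 5 (c k) (c (k + 1))) → FreeTail.IsWitnessedChain 5 c j b →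
      (∀ e ∈ (c 0).F.support, (c 0).r ≤ e) → (∀ k, ordZero (c k).F ≠ (5 : ℕ)) →
      ∀ k₀ : ℕ, (∀ k, k₀ ≤ k → (c k).shade = ((4 : ℕ) : ℕ∞)) →
      (∀ k, k₀ ≤ k → Module.finrank K (resVertex (c k)) = 2) →
      ∀ k₁ : ℕ, k₀ ≤ k₁ → (∀ k, k₁ ≤ k → (∃ W, (c k).r W = 2 ∧ ∀ i, i ≠ W → (c k).r i ≤ 1) ∧
        (2 ≤ (c k).r.degree ∧ (c k).r.degree ≤ 3)) →
      ∃ (c' : ℕ → State K) (j' : ℕ → Fin 4) (b' : ℕ → Fin 4 → K) (k₀' : ℕ) (a a' : Fin 4),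
        (∀ k, IsIsolated 5 (c' k).F ∧ Step0 5 (c' k) (c' (k + 1))) ∧ FreeTail.IsWitnessedChain 5 c' j' b' ∧
        (∀ e ∈ (c' 0).F.support, (c' 0).r ≤ e) ∧ (∀ k, ordZero (c' k).F ≠ (5 : ℕ)) ∧
        (∀ k, k₀' ≤ k → (c' k).shade = ((4 : ℕ) : ℕ∞)) ∧
        (∀ k, k₀' ≤ k → Module.finrank K (resVertex (c' k)) = 2) ∧ a ≠ a' ∧
        (∀ k, k₀' ≤ k → (j' k = a ∨ j' k = a')) ∧
        (∀ k, k₀' ≤ k → ∀ i, i ≠ a → i ≠ a' → (c' k).r i = 0)) :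
    NoAboveFloorTrap 5 5 := by
  refine noAboveFloorTrap_five_iff_tails.mpr fun K _ _ _ => ⟨?_, ?_⟩
  · intro c j b hc hw hr0 hfloor k₀ hshade he
    exact tailB_three_five_of_KL_of_light hc hw hr0 hfloor hshade he
      (fun hl => no_light_three_tail_of_representation (hN4C K) c j b hc hw hr0 hfloor k₀ hshade he hl)
      (hK K c j b hc hw hr0 hfloor k₀ hshade he) (hL K c j b hc hw hr0 hfloor k₀ hshade he)
  · intro c j b hc hw hr0 hfloor k₀ hshade he
    exact tailD_of_representations (hN4C' K) (hN4D K)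
      (fun c j b hc hw hr0 hfloor k₀ hshade he a a' haa hletters hpass =>
        no_pair_tail_four_five hc hw hr0 (fun k => by exact_mod_cast hfloor k) hshade he haa hletters hpass)
      c j b hc hw hr0 hfloor k₀ hshade he

end ResCone

end Summit.ResolutionOfSingularities.ResolutionOfSingularities.Theorems.PIDim4

end
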